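import Summits.SmoothPoincare4.SmoothPoincare4.Theorems.WeakReductionDescentGenusThreeBase
import Summits.SmoothPoincare4.SmoothPoincare4.Theorems.WeakReductionDescentSphereSumSphere
import Literature.Topology.FourManifolds.TrisectionFunctorGKNaturality
import Literature.Topology.FourManifolds.SphereTrisectionsSectors

/-!
# SmoothPoincare4 / WeakReductionDescent — `GenusThreeBase` needs only the Aranda–Zupan DICHOTOMY

Item stmt-SmoothPoincare4-17910 (`GenusThreeBase`, support, rank 9 of route WeakReductionDescent) is,
kernel-checked (`genusThreeBase_iff_az2025`, sibling file `WeakReductionDescentGenusThreeBase.lean`),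
the unproved named fact
`Literature.Barriers.SmoothPoincare4.az2025_weaklyReducible_genusThree_homotopySphere_gk.{0}` — the
homotopy-sphere corollary of the WHOLE of Aranda–Zupan 2025, Thm. 1.3 (arXiv:2503.04607, p. 2):
"Suppose `X` admits a weakly reducible genus-three trisection `T`. Then either `T` is reducible, or
`T` contains a five-chain. In particular, `X` is diffeomorphic to a spun lens space `S_p` or its
sibling `S'_p`, `S⁴`, or a connected sum of copies of `±ℂP²`, `S¹ × S³`, and `S² × S²`."

The printed theorem has TWO parts (§6, p. 20: "That every weakly reducible genus-three trisection
is reducible or contains a five-chain, and that the corresponding 4-manifolds are `S_p`, `S'_p`, or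
a short list of standard simply-connected manifolds"), and its proof (§6, pp. 20–24) treats the
REDUCIBLE branch by splitting `X = X' # X''` into trisections of genus one and two and quoting the
genus-`≤ 2` classification [MZ17b] — exactly the content the route ALREADY carries as its own items
`ReducibleSplits` (stmt-SmoothPoincare4-17909) and `LowGenusBase` (stmt-SmoothPoincare4-17911) —
while the NON-reducible branch ends (p. 24) in `S_p`, `S'_p` (the two surgeries on a loop of class
`p ∈ ℤ = π₁(S¹ × S³)`, §2 p. 7: `π₁ = ℤ/p`, and "when `p = 1`, `S_1` and `S'_1` are diffeomorphic to
`S⁴`"; `ℓ₋ₚ` is `ℓₚ` reversed) or in `S² × S²`, `ℂP² # -ℂP²` (surgery on a loop in `S⁴`; `b₂ = 2`),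
whose only homotopy 4-sphere is `S⁴`.

This file records, kernel-checked and WITHOUT introducing any new named fact, that the route's
`g = 3` rung needs only the homotopy-sphere form of the DICHOTOMY — stated inline over the
Statement's bare binders with the tree's vocabulary
`Literature.Topology.FourManifolds.Trisection.IsWeaklyReducible` /
`Literature.Topology.FourManifolds.Trisection.IsReducible` (which unfold by `rfl` to the route's
`let`-blocks, `Trisection.isWeaklyReducible_iff` / `isReducible_iff`):

  `(D)  ∀ M (bare binders), M ≃ₕ S⁴ → ∀ k T, IsGKTrisection M 3 k T → IsWeaklyReducible T →
          IsReducible T ∨ Nonempty (M ≅ S⁴)`.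

* `genusThreeBase_of_isReducible_or` — `(D) → ReducibleSplits → LowGenusBase → GenusThreeBase`
  (the proved item `SphereSumSphere` closes the reducible branch: the summands have genus `≤ 2`).
* `isReducible_or_of_genusThreeBase` — conversely `GenusThreeBase → (D)` (trivially), so MODULO the
  route's own items `ReducibleSplits` and `LowGenusBase` the item is EQUIVALENT to `(D)`: the
  classification half of AZ25 Thm. 1.3 is not owed a second time at `g = 3`.
* `isReducible_or_of_az2025` — the vendored fact gives `(D)` (so nothing here is stronger than what
  the tree already assumes for this item).
* `isReducible_of_minimal_of_isReducible_or` — `(D)` also yields the `g = 3` case of the crux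
  `WeakReductionReduces` (stated by the planner for `g ≥ 4` only): a weakly reducible genus-`3`
  GK-trisection of a smooth homotopy 4-sphere that is of MINIMAL genus is reducible — if `M ≅ S⁴`,
  transport the genus-`0` trisection of the round sphere
  (`Literature.Topology.FourManifolds.sphere_genusZero_gkTrisection_holds`, PROVED) along the
  diffeomorphism (`Literature.Topology.FourManifolds.IsGKTrisection.image_diffeomorph'`, PROVED),
  contradicting minimality; `isReducible_of_minimal_of_three_le` combines this with the crux as
  filed (`g ≥ 4`) into the `g ≥ 3` form, under which `closes` would not use `GenusThreeBase`.

All five are `--supports` helpers for stmt-SmoothPoincare4-17910; the item itself stays closed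
MODULO the named fact (an unconditional close is the discharge `…_gk_holds`, absent from the tree).
-/

-- the registered namespace `Summit.SmoothPoincare4.SmoothPoincare4.Theorems` repeats a component
set_option linter.dupNamespace false

namespace Summit.SmoothPoincare4.SmoothPoincare4.Theorems

open scoped Manifold ContDiff ContinuousMap
open Summit.SmoothPoincare4.SmoothPoincare4.Theses.WeakReductionDescent
open Literature.Topology.FourManifolds Literature.Topology.FourManifolds.Trisection

/-- **`GenusThreeBase` from the Aranda–Zupan dichotomy and the route's own items.** If every weakly
reducible genus-`3` GK-trisection of a smooth homotopy 4-sphere `M` is reducible unless `M ≅ S⁴`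
(hypothesis `hD`: the homotopy-sphere form of AZ25 Thm. 1.3, first sentence, with the non-reducible
branch of its proof, §6 p. 24 and §2 p. 7), then `GenusThreeBase` follows from the route items
`ReducibleSplits` (a reducible trisection of genus `g` of a homotopy sphere splits it as `A # B`,
homotopy spheres trisected with genera `< g`) and `LowGenusBase` (genus `≤ 2` ⇒ `≅ S⁴`), the last
step `S⁴ # S⁴ ≅ S⁴` being the PROVED item `SphereSumSphere_proof`. Conditional on `hD` and on the
two items (D-0014). [cite: ArandaZupan2025, Thm. 1.3 (p. 2) and §6 (pp. 20, 24)] -/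
theorem genusThreeBase_of_isReducible_or
    (hD : ∀ (M : Type) [TopologicalSpace M] [T2Space M] [SecondCountableTopology M]
      [ChartedSpace (EuclideanSpace ℝ (Fin 4)) M] [IsManifold (𝓡 4) ((⊤ : ℕ∞) : WithTop ℕ∞) M],
      (M ≃ₕ (Metric.sphere (0 : EuclideanSpace ℝ (Fin 5)) 1)) → ∀ (k : Fin 3 → ℕ) (T : Fin 3 → Set M),
      IsGKTrisection M 3 k T → IsWeaklyReducible T →
      IsReducible T ∨ Nonempty (Diffeomorph (𝓡 4) (𝓡 4) M
        (Metric.sphere (0 : EuclideanSpace ℝ (Fin 5)) 1) ((⊤ : ℕ∞) : WithTop ℕ∞)))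
    (h3 : ReducibleSplits) (h5 : LowGenusBase) : GenusThreeBase := by
  unfold GenusThreeBase
  intro M _ _ _ _ _ e k T hT hwr
  have hwr' : IsWeaklyReducible T := hwr
  rcases hD M e k T hT hwr' with hred | hdiff
  · obtain ⟨A, _, _, _, _, _, eA, B, _, _, _, _, _, eB, ga, gb, ka, kb, TA, TB, hA, hB, hga, hgb,
      hsum⟩ := h3 M e 3 k T hT hred
    exact SphereSumSphere_proof A B M hsum (h5 A eA ga ka TA hA (by omega))
      (h5 B eB gb kb TB hB (by omega))
  · exact hdiff

/-- **Conversely, `GenusThreeBase` gives the dichotomy** (its second disjunct), so that MODULO the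
route items `ReducibleSplits` and `LowGenusBase` the item `GenusThreeBase` is equivalent to the
homotopy-sphere form of the Aranda–Zupan dichotomy. [cite: ArandaZupan2025, Thm. 1.3 (p. 2)] -/
theorem isReducible_or_of_genusThreeBase (h : GenusThreeBase) :
    ∀ (M : Type) [TopologicalSpace M] [T2Space M] [SecondCountableTopology M]
      [ChartedSpace (EuclideanSpace ℝ (Fin 4)) M] [IsManifold (𝓡 4) ((⊤ : ℕ∞) : WithTop ℕ∞) M],
      (M ≃ₕ (Metric.sphere (0 : EuclideanSpace ℝ (Fin 5)) 1)) → ∀ (k : Fin 3 → ℕ) (T : Fin 3 → Set M),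
      IsGKTrisection M 3 k T → IsWeaklyReducible T →
      IsReducible T ∨ Nonempty (Diffeomorph (𝓡 4) (𝓡 4) M
        (Metric.sphere (0 : EuclideanSpace ℝ (Fin 5)) 1) ((⊤ : ℕ∞) : WithTop ℕ∞)) := by
  intro M _ _ _ _ _ e k T hT hwr
  exact Or.inr (h M e k T hT hwr)

/-- **The vendored fact gives the dichotomy**: from
`Literature.Barriers.SmoothPoincare4.az2025_weaklyReducible_genusThree_homotopySphere_gk.{0}`
(AZ25 Thm. 1.3, homotopy-sphere corollary) the homotopy-sphere dichotomy follows (through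
`genusThreeBase_of_az2025`), so the hypothesis `hD` of `genusThreeBase_of_isReducible_or` is at
most as strong as what the tree already assumes for this item. [cite: ArandaZupan2025, Thm. 1.3 (p. 2)] -/
theorem isReducible_or_of_az2025
    (hAZ : Literature.Barriers.SmoothPoincare4.az2025_weaklyReducible_genusThree_homotopySphere_gk.{0}) :
    ∀ (M : Type) [TopologicalSpace M] [T2Space M] [SecondCountableTopology M]
      [ChartedSpace (EuclideanSpace ℝ (Fin 4)) M] [IsManifold (𝓡 4) ((⊤ : ℕ∞) : WithTop ℕ∞) M],
      (M ≃ₕ (Metric.sphere (0 : EuclideanSpace ℝ (Fin 5)) 1)) → ∀ (k : Fin 3 → ℕ) (T : Fin 3 → Set M),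
      IsGKTrisection M 3 k T → IsWeaklyReducible T →
      IsReducible T ∨ Nonempty (Diffeomorph (𝓡 4) (𝓡 4) M
        (Metric.sphere (0 : EuclideanSpace ℝ (Fin 5)) 1) ((⊤ : ℕ∞) : WithTop ℕ∞)) :=
  isReducible_or_of_genusThreeBase (genusThreeBase_of_az2025 hAZ)

/-- **The dichotomy yields the `g = 3` case of the crux `WeakReductionReduces`.** If every weakly
reducible genus-`3` GK-trisection of a smooth homotopy 4-sphere is reducible unless the manifold is
`S⁴` (hypothesis `hD`), then a weakly reducible genus-`3` GK-trisection `T` of a smooth homotopy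
4-sphere `M` which is of MINIMAL genus among the GK-trisections of `M` is reducible: otherwise
`M ≅ S⁴`, and the genus-`0` trisection of the round sphere (Gay–Kirby §2, PROVED:
`Literature.Topology.FourManifolds.sphere_genusZero_gkTrisection_holds`) transported along the
diffeomorphism (`Literature.Topology.FourManifolds.IsGKTrisection.image_diffeomorph'`, PROVED)
is a GK-trisection of `M` of genus `0 < 3`, contradicting minimality.
[cite: ArandaZupan2025, Thm. 1.3 (p. 2)] [cite: GayKirby2016, §2 (first example) and Def. 1] -/
theorem isReducible_of_minimal_of_isReducible_or
    (hD : ∀ (M : Type) [TopologicalSpace M] [T2Space M] [SecondCountableTopology M]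
      [ChartedSpace (EuclideanSpace ℝ (Fin 4)) M] [IsManifold (𝓡 4) ((⊤ : ℕ∞) : WithTop ℕ∞) M],
      (M ≃ₕ (Metric.sphere (0 : EuclideanSpace ℝ (Fin 5)) 1)) → ∀ (k : Fin 3 → ℕ) (T : Fin 3 → Set M),
      IsGKTrisection M 3 k T → IsWeaklyReducible T →
      IsReducible T ∨ Nonempty (Diffeomorph (𝓡 4) (𝓡 4) M
        (Metric.sphere (0 : EuclideanSpace ℝ (Fin 5)) 1) ((⊤ : ℕ∞) : WithTop ℕ∞)))
    (M : Type) [TopologicalSpace M] [T2Space M] [SecondCountableTopology M]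
    [ChartedSpace (EuclideanSpace ℝ (Fin 4)) M] [IsManifold (𝓡 4) ((⊤ : ℕ∞) : WithTop ℕ∞) M]
    (e : M ≃ₕ (Metric.sphere (0 : EuclideanSpace ℝ (Fin 5)) 1)) (k : Fin 3 → ℕ) (T : Fin 3 → Set M)
    (hT : IsGKTrisection M 3 k T)
    (hmin : ∀ (g' : ℕ) (k' : Fin 3 → ℕ) (T' : Fin 3 → Set M), IsGKTrisection M g' k' T' → 3 ≤ g')
    (hwr : IsWeaklyReducible T) : IsReducible T := by
  rcases hD M e k T hT hwr with hred | hΦ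
  · exact hred
  · exfalso
    obtain ⟨Φ⟩ := hΦ
    obtain ⟨S₀, hS₀⟩ := sphere_genusZero_gkTrisection_holds
    have h0 : IsGKTrisection M 0 (fun _ => 0) (fun i => Φ.symm '' S₀ i) :=
      hS₀.isGKTrisection.image_diffeomorph' Φ.symm
    exact absurd (hmin 0 _ _ h0) (by norm_num)

/-- **Hence, given the dichotomy, the crux `WeakReductionReduces` extends from `g ≥ 4` to `g ≥ 3`:**
a weakly reducible MINIMAL-genus GK-trisection of genus `g ≥ 3` of a smooth homotopy 4-sphere is
reducible — the case `g = 3` by `isReducible_of_minimal_of_isReducible_or`, the cases `g ≥ 4` by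
the crux itself (whose inline weak-reducibility / reducibility blocks are, by `rfl`, the tree's
`Trisection.IsWeaklyReducible` / `Trisection.IsReducible`).  With `WeakReductionReduces` so
extended, the route's deciding theorem `closes` would not need `GenusThreeBase` at all
(`g = 3`: minimal ⇒ weakly reducible (`MinimalWeaklyReducible`) ⇒ reducible ⇒ `ReducibleSplits` ⇒
summands of genus `≤ 2` ⇒ `LowGenusBase` ⇒ `SphereSumSphere`); recorded for the planner, nothing
is restated. [cite: ArandaZupan2025, Thm. 1.3 (p. 2)] -/
theorem isReducible_of_minimal_of_three_le
    (hD : ∀ (M : Type) [TopologicalSpace M] [T2Space M] [SecondCountableTopology M]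
      [ChartedSpace (EuclideanSpace ℝ (Fin 4)) M] [IsManifold (𝓡 4) ((⊤ : ℕ∞) : WithTop ℕ∞) M],
      (M ≃ₕ (Metric.sphere (0 : EuclideanSpace ℝ (Fin 5)) 1)) → ∀ (k : Fin 3 → ℕ) (T : Fin 3 → Set M),
      IsGKTrisection M 3 k T → IsWeaklyReducible T →
      IsReducible T ∨ Nonempty (Diffeomorph (𝓡 4) (𝓡 4) M
        (Metric.sphere (0 : EuclideanSpace ℝ (Fin 5)) 1) ((⊤ : ℕ∞) : WithTop ℕ∞)))
    (h2 : WeakReductionReduces)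
    (M : Type) [TopologicalSpace M] [T2Space M] [SecondCountableTopology M]
    [ChartedSpace (EuclideanSpace ℝ (Fin 4)) M] [IsManifold (𝓡 4) ((⊤ : ℕ∞) : WithTop ℕ∞) M]
    (e : M ≃ₕ (Metric.sphere (0 : EuclideanSpace ℝ (Fin 5)) 1)) (g : ℕ) (k : Fin 3 → ℕ)
    (T : Fin 3 → Set M) (hT : IsGKTrisection M g k T) (hg : 3 ≤ g)
    (hmin : ∀ (g' : ℕ) (k' : Fin 3 → ℕ) (T' : Fin 3 → Set M), IsGKTrisection M g' k' T' → g ≤ g')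
    (hwr : IsWeaklyReducible T) : IsReducible T := by
  rcases Nat.lt_or_ge g 4 with hlt | hge
  · obtain rfl : g = 3 := by omega
    exact isReducible_of_minimal_of_isReducible_or hD M e k T hT hmin hwr
  · exact h2 M e g k T hT hge hmin hwr

end Summit.SmoothPoincare4.SmoothPoincare4.Theorems
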